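import Mathlib.RepresentationTheory.Homological.ContCohomology.Functoriality
import Literature.AnabelianGeometry.AbsoluteAnabelian.AbsTopIII.CuspidalCyclotome
import Literature.AnabelianGeometry.AbsoluteAnabelian.AbsCuspFacts
import HarnessLib

/-!
# [AbsCusp] Prop. 2.1 (i), (ii): `H¹` of the cuspidalizations of `U_S` with coefficients `M_X`

S. Mochizuki, *Absolute anabelian cuspidalizations of proper hyperbolic curves*, J. Math. Kyoto
Univ. 47 (2007), Prop. 2.1 pp. 35–36 of the held copy (lit key `paper:doi-10-1215-kjm-1250281022`)
[cite: MochizukiAbsCusp2007, Prop 2.1 (i) p.35] — the two cohomological items of plan/L4/LC1-CHAIN.md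
§2 M3 that [AbsTopIII] Cor. 1.10 (iii)(g) p. 43 cites ("the subgroup
`P_{U_S} ⊆ H¹(Π^{c-ab}_{U_S}, μ_Ẑ(Π_X)) (≅ H¹(Π_{U_S}, μ_Ẑ(Π_X)))` [cf. [Mzk19], Proposition 2.1,
(i), (ii)]").  They were "recorded by locator only" in `AbsCuspFacts.lean` (p405610); this file
types them as REAL statements over abc-iut-L4-t1's kernel objects (`CuspidalCyclotome.lean`,
p405975): the cyclotome `M_X = geomCyclotome q` inside `Π_{U_x}/[N, Δ]⁻` for a presentation
`q : Π_{U_x} → Π_X`, its continuous `Π_{U_S}`-module structure `geomCyclotomeRep r q` along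
`r : Π_{U_S} → Π_{U_x}` (`x ∈ S`), and `H¹(Π_{U_S}, M_X) = geomCyclotomeH1 r q` (Mathlib continuous
cohomology).

## What is constructed (REAL) and what is stated

* The quotients "`Π_{U_S} ↠ Π^{c-ab}_{U_S} ↠ Π^{c-cn}_{U_S}`" of Prop. 2.1 p. 35 ("the maximal
  cuspidally abelian and maximal cuspidally central quotients" relative to `Π_{U_S} ↠ Π_X`):
  `MaxCuspAbelianOver r q := Π_{U_S}/[I, I]⁻` with `I = Ker(Π_{U_S} → Π_X)` ([AbsCusp] Def. 1.1
  (i), `AbsCusp.cuspidalSubgroup`), and t1's `AbsTopIII.CuspidallyCentralQuotient (r ≫ q) =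
  Π_{U_S}/[I ∩ Δ_{U_S}, Δ_{U_S}]⁻`; PROVED: the action of `Π_{U_S}` on `M_X` descends to both
  (`ccnModulus_le_ker`, `cuspAbelianModulus_le_ker`), giving `ccnRep`, the continuous quotient
  maps `piAb`, `piCn`, and `res_piAb_piCn_apply`: the pulled-back action is t1's `geomCyclotomeRep` elementwise.
* Prop. 2.1 (i) p. 35: "The natural surjections induce isomorphisms
  `H¹(Π^{c-cn}_{U_S}, M_X) ⥲ H¹(Π^{c-ab}_{U_S}, M_X) ⥲ H¹(Π_{U_S}, M_X)`" → `Prop_2_1_i r q hI`: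
  both inflation maps (`ContinuousCohomology.map` along `piCn`, `piAb`) are isomorphisms.
* Prop. 2.1 (ii) p. 36, exactness clause: "restricting cohomology classes of `Π_{U_S}` to the
  various `I_x[U_S]`, for `x ∈ S`, yields a natural exact sequence
  `1 → (k^×)^∧ → H¹(Π_{U_S}, M_X) → ⊕_{x∈S} Ẑ†`" — TYPED VIA INFLATION–RESTRICTION as the
  equality of kernels "a class restricts to zero on every `I_x` (`x ∈ S`) iff it restricts to zero
  on `Δ_{U_S}`" (`Prop_2_1_ii_ker`): the classes vanishing on `Δ_{U_S}` are exactly the image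
  of `H¹(G_k, M_X)`, which is `(k^×)^∧` by Kummer theory ([AbsCusp] p. 10, display preceding
  Def. 1.1); the identifications `Hom(I_x[U_S], M_X) = Ẑ†` and `H¹(G_k, M_X) ≅ (k^×)^∧` themselves and
  the second clause of (ii) (image of `Γ(U_S, 𝒪^×)` = preimage of the principal divisors) need
  geometric data (t1's `KummerCurveModel.kummer`; divisors) and are NOT typed here.
* (M)-forms over t1's `CurveModel` for presentations `U_S ⊆ U_x ⊆ X` with
  `IsCyclotomePresentation` (`x ∈ S` a rational cusp), MLF base field, `Σ = 𝔓𝔯𝔦𝔪𝔢𝔰`: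
  `Prop_2_1_i_model`, `Prop_2_1_ii_model`.

Hypothesis `hI : I ≤ Δ_{U_S}` (automatic when the `G`-components of `r`, `q` are injective, as
for `CurveModel.res`) is what makes `[I, I] ≤ [I ∩ Δ, Δ]`.  HONEST FRAMING: refereed result,
statements-first (D-0014); no side taken on [IUTchIII] Cor. 3.12; typed ≠ discharged.
-/

noncomputable section

open CategoryTheory
open scoped Classical Pointwise IsMulCommutative

namespace Literature.AnabelianGeometry.AbsoluteAnabelian

namespace AbsCusp

open AbsTopIII

universe u

variable {E' E F : FundamentalExtension.{u}} (r : E' ⟶ E) (q : E ⟶ F)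

/-! ### The cuspidal subgroup of `Π_{U_S} ↠ Π_X` and the maximal cuspidally abelian quotient -/

/-- `I := Ker(Π_{U_S} → Π_X)` for the composite presentation `U_S ⊆ U_x ⊆ X` ([AbsCusp] Def. 1.1 (i)).
[cite: MochizukiAbsCusp2007, Prop 2.1 p.35] -/
abbrev cuspidalOver : Subgroup E'.arith := cuspidalSubgroup (r ≫ q).arith.toMonoidHom

/-- `[I, I]⁻`: `Π_{U_S}/[I, I]⁻ = Π^{c-ab}_{U_S}`, "the maximal cuspidally abelian quotient"
(Prop. 2.1 p. 35); the same object as `(CuspidalizationData.cuspidallyAbelianModulus)` of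
`AbsCuspFacts.lean` for the datum `⟨Π_{U_S}, (r ≫ q).arith, _⟩`, here without the surjectivity
field (not needed to define the representations). [cite: MochizukiAbsCusp2007, Prop 2.1 p.35] -/
def cuspAbelianModulus : Subgroup E'.arith :=
  (⁅cuspidalOver r q, cuspidalOver r q⁆).topologicalClosure

/-- `[I, I]⁻` is normal. [cite: MochizukiAbsCusp2007, Prop 2.1 p.35] -/
instance cuspAbelianModulus_normal : (cuspAbelianModulus r q).Normal := by
  have : (⁅cuspidalOver r q, cuspidalOver r q⁆).Normal := Subgroup.commutator_normal _ _
  exact Subgroup.is_normal_topologicalClosure _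

/-- `Π^{c-ab}_{U_S} := Π_{U_S}/[I, I]⁻` (a topological group). [cite: MochizukiAbsCusp2007, Prop 2.1 p.35] -/
abbrev MaxCuspAbelianOver : Type u := E'.arith ⧸ cuspAbelianModulus r q

/-! ### Descent of the action on `M_X` to the two quotients -/

/-- The action `Π_{U_S} → Π_{U_x}/[N, Δ]⁻` on `M_X` kills `[I ∩ Δ_{U_S}, Δ_{U_S}]⁻` (t1's
`AbsTopIII.cuspidallyCentralModulus (r ≫ q)`): `r` maps `I ∩ Δ_{U_S}` into `N = Ker(Π_{U_x} → Π_X) ∩ Δ`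
and `Δ_{U_S}` into `Δ_{U_x}`. [cite: MochizukiAbsCusp2007, Prop 2.1 (i) p.35] -/
theorem ccnModulus_le_ker :
    AbsTopIII.cuspidallyCentralModulus (r ≫ q) ≤ (toCuspidallyCentralQuotient r q).ker := by
  haveI : IsClosed ((AbsTopIII.cuspidallyCentralModulus q : Subgroup E.arith) : Set E.arith) :=
    Subgroup.isClosed_topologicalClosure _
  have hcont : Continuous (toCuspidallyCentralQuotient r q) :=
    QuotientGroup.continuous_mk.comp r.arith.continuous
  have hclosed : IsClosed ((toCuspidallyCentralQuotient r q).ker : Set E'.arith) := by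
    change IsClosed ((toCuspidallyCentralQuotient r q) ⁻¹' {1})
    exact isClosed_singleton.preimage hcont
  refine Subgroup.topologicalClosure_minimal _ ?_ hclosed
  rw [Subgroup.commutator_le]
  intro a ha b hb
  have ha' : r.arith a ∈ cuspidalKernel q := by
    refine Subgroup.mem_inf.mpr ⟨?_, r.mapsTo_geom (Subgroup.mem_inf.mp ha).2⟩
    have h1 := (Subgroup.mem_inf.mp ha).1
    rw [MonoidHom.mem_ker] at h1 ⊢
    change (r ≫ q).arith a = 1 at h1
    rwa [FundamentalExtension.comp_arith] at h1
  have hb' : r.arith b ∈ E.geom := r.mapsTo_geom hb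
  have hmem := Subgroup.le_topologicalClosure _ (Subgroup.commutator_mem_commutator ha' hb')
  rw [commutatorElement_def] at hmem
  rw [MonoidHom.mem_ker]
  change QuotientGroup.mk' (AbsTopIII.cuspidallyCentralModulus q) (r.arith (a * b * a⁻¹ * b⁻¹)) = 1
  rw [QuotientGroup.mk'_apply, QuotientGroup.eq_one_iff]
  have h2 : r.arith (a * b * a⁻¹ * b⁻¹) = r.arith a * r.arith b * (r.arith a)⁻¹ * (r.arith b)⁻¹ := by
    simp only [map_mul, map_inv]
  rw [h2]
  exact hmem

/-- With `I ≤ Δ_{U_S}`: `[I, I]⁻ ≤ [I ∩ Δ_{U_S}, Δ_{U_S}]⁻`, so `Π^{c-ab}_{U_S} ↠ Π^{c-cn}_{U_S}`.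
[cite: MochizukiAbsCusp2007, Prop 2.1 p.35] -/
theorem cuspAbelianModulus_le_ccnModulus (hI : cuspidalOver r q ≤ E'.geom) :
    cuspAbelianModulus r q ≤ AbsTopIII.cuspidallyCentralModulus (r ≫ q) := by
  have hle : cuspidalOver r q ≤ cuspidalKernel (r ≫ q) := fun x hx => Subgroup.mem_inf.mpr ⟨hx, hI hx⟩
  exact Subgroup.topologicalClosure_mono (Subgroup.commutator_mono hle hI)

/-- The action of `Π_{U_S}` on `M_X` kills `[I, I]⁻` (given `I ≤ Δ_{U_S}`).
[cite: MochizukiAbsCusp2007, Prop 2.1 (i) p.35] -/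
theorem cuspAbelianModulus_le_ker (hI : cuspidalOver r q ≤ E'.geom) :
    cuspAbelianModulus r q ≤ (toCuspidallyCentralQuotient r q).ker :=
  (cuspAbelianModulus_le_ccnModulus r q hI).trans (ccnModulus_le_ker r q)

/-- `Π^{c-cn}_{U_S} → Π_{U_x}/[N, Δ]⁻`, the descended action map. [cite: MochizukiAbsCusp2007, Prop 2.1 (i) p.35] -/
def ccnToQuotient : CuspidallyCentralQuotient (r ≫ q) →* CuspidallyCentralQuotient q :=
  QuotientGroup.lift _ (toCuspidallyCentralQuotient r q) (ccnModulus_le_ker r q)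

/-- `M_X` as a continuous `ℤ`-linear representation of `Π^{c-cn}_{U_S}` (conjugation through
`ccnToQuotient`). [cite: MochizukiAbsCusp2007, Prop 2.1 (i) p.35] -/
def ccnRep : ContRepresentation ℤ (CuspidallyCentralQuotient (r ≫ q)) (Additive (geomCyclotome q)) :=
  (conjRep (geomCyclotome q)).restrict (ccnToQuotient r q)

/-- `M_X` as an object of `TopRep ℤ Π^{c-cn}_{U_S}`. [cite: MochizukiAbsCusp2007, Prop 2.1 (i) p.35] -/
abbrev ccnTopRep : TopRep.{u} ℤ (CuspidallyCentralQuotient (r ≫ q)) := TopRep.of (ccnRep r q)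

/-- The quotient map `Π_{U_S} ↠ Π^{c-ab}_{U_S}` as a continuous homomorphism.
[cite: MochizukiAbsCusp2007, Prop 2.1 p.35] -/
def piAb : E'.arith →ₜ* MaxCuspAbelianOver r q :=
  { toMonoidHom := QuotientGroup.mk' (cuspAbelianModulus r q)
    continuous_toFun := QuotientGroup.continuous_mk }

/-- The quotient map `Π^{c-ab}_{U_S} ↠ Π^{c-cn}_{U_S}` as a continuous homomorphism (given
`I ≤ Δ_{U_S}`). [cite: MochizukiAbsCusp2007, Prop 2.1 p.35] -/
def piCn (hI : cuspidalOver r q ≤ E'.geom) :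
    MaxCuspAbelianOver r q →ₜ* CuspidallyCentralQuotient (r ≫ q) :=
  { toMonoidHom := QuotientGroup.map (cuspAbelianModulus r q) (AbsTopIII.cuspidallyCentralModulus (r ≫ q))
      (MonoidHom.id _) (by
        rw [Subgroup.comap_id]
        exact cuspAbelianModulus_le_ccnModulus r q hI)
    continuous_toFun := by
      refine (QuotientGroup.isQuotientMap_mk (cuspAbelianModulus r q)).continuous_iff.mpr ?_
      exact QuotientGroup.continuous_mk }

/-- The `Π_{U_S}`-module obtained by pulling `M_X` back along `Π_{U_S} ↠ Π^{c-ab}_{U_S} ↠ Π^{c-cn}_{U_S}`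
is t1's `geomCyclotomeRep r q`: the actions agree elementwise.
[cite: MochizukiAbsCusp2007, Prop 2.1 (i) p.35] -/
theorem res_piAb_piCn_apply (hI : cuspidalOver r q ≤ E'.geom) (g : E'.arith)
    (v : Additive (geomCyclotome q)) :
    ((ccnRep r q).restrict
        ((piCn r q hI : MaxCuspAbelianOver r q →* CuspidallyCentralQuotient (r ≫ q)).comp
          (piAb r q : E'.arith →* MaxCuspAbelianOver r q))) g v =
      geomCyclotomeRep r q g v :=
  rfl

/-! ### Proposition 2.1 (i), p. 35 -/

/-- [AbsCusp] Prop. 2.1 (i), as a property of a presentation `U_S ⊆ U_x ⊆ X` (`r : Π_{U_S} → Π_{U_x}`,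
`q : Π_{U_x} → Π_X`, `M_X = geomCyclotome q`) with `I ≤ Δ_{U_S}`: "The natural surjections induce
isomorphisms `H¹(Π^{c-cn}_{U_S}, M_X) ⥲ H¹(Π^{c-ab}_{U_S}, M_X) ⥲ H¹(Π_{U_S}, M_X)`" — both inflation
maps on Mathlib's continuous cohomology in degree `1` are isomorphisms (the second lands in t1's
`geomCyclotomeH1 r q`, cf. `res_piAb_piCn_apply`). [cite: MochizukiAbsCusp2007, Prop 2.1 (i) p.35] -/
def Prop_2_1_i (hI : cuspidalOver r q ≤ E'.geom) : Prop :=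
  IsIso (ContinuousCohomology.map.{0, u, u} (piCn r q hI)
    (𝟙 (TopRep.res (piCn r q hI : MaxCuspAbelianOver r q →* CuspidallyCentralQuotient (r ≫ q))
      (ccnTopRep r q))) 1) ∧
  IsIso (ContinuousCohomology.map.{0, u, u} (piAb r q)
    (𝟙 (TopRep.res (piAb r q : E'.arith →* MaxCuspAbelianOver r q)
      (TopRep.res (piCn r q hI : MaxCuspAbelianOver r q →* CuspidallyCentralQuotient (r ≫ q))
        (ccnTopRep r q)))) 1)

/-! ### Proposition 2.1 (ii), p. 36 — exactness at `H¹(Π_{U_S}, M_X)` -/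

/-- [AbsCusp] Prop. 2.1 (ii), exactness clause, as a property of the presentation and of the inertia
groups `I x ⊆ Π_{U_S}` of the cusps `x ∈ S` (`S ⊆ X(k)` finite, `U_S = X ∖ S`): "restricting
cohomology classes of `Π_{U_S}` to the various `I_x[U_S]`, for `x ∈ S`, yields a natural exact
sequence `1 → (k^×)^∧ → H¹(Π_{U_S}, M_X) → ⊕_{x∈S} Ẑ†`" — TYPED VIA INFLATION–RESTRICTION: a class of
`H¹(Π_{U_S}, M_X)` restricts to zero on every `I_x` iff it restricts to zero on `Δ_{U_S}` (i.e. lies in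
the image of `H¹(G_k, M_X) ≅ (k^×)^∧`).  Restrictions are t1's `geomCyclotomeH1Res`.
[cite: MochizukiAbsCusp2007, Prop 2.1 (ii) p.36] -/
def Prop_2_1_ii_ker {S : Type u} (I : S → Subgroup E'.arith) : Prop :=
  ∀ c : geomCyclotomeH1 r q,
    (∀ x : S, geomCyclotomeH1Res r q (I x) c = 0) ↔ geomCyclotomeH1Res r q E'.geom c = 0

/-! ### Model-relative forms over `CurveModel` -/

/-- [AbsCusp] Prop. 2.1 (i) relative to `M` (nonarchimedean local base field, `Σ = 𝔓𝔯𝔦𝔪𝔢𝔰`): for every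
presentation `U_S ⊆ U_x ⊆ X` of the model by cofinite opens of scheme-like curves with `X` PROPER
over an MLF and `x ∈ S` a rational cusp exhibiting `M_X` (`IsCyclotomePresentation`), and with
`Ker(Π_{U_S} → Π_X) ≤ Δ_{U_S}` (automatic for the intended model, [AbsTopIII] Prop. 1.4 (i)),
`Prop_2_1_i` holds.  NAMED FACT relative to `M`. [cite: MochizukiAbsCusp2007, Prop 2.1 (i) p.35] -/
def Prop_2_1_i_model (M : CurveModel.{u}) : Prop :=
  ∀ (US Ux X : M.Curve) (h₁ : M.IsCofiniteOpen US Ux) (h₂ : M.IsCofiniteOpen Ux X)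
    (x : (M.cusps Ux).Cusp) (hI : cuspidalOver (M.res h₁) (M.res h₂) ≤ (M.ext US).geom),
    M.IsScheme US → M.IsCyclotomePresentation h₂ x → IsMLF (M.base X) →
      Prop_2_1_i (M.res h₁) (M.res h₂) hI

/-- [AbsCusp] Prop. 2.1 (ii) (exactness clause) relative to `M`: same setting, all cusps of `U_S`
rational ("`S ⊆ X(k)`"); `Prop_2_1_ii_ker` for the cuspidal inertia groups of `U_S`.  NAMED FACT
relative to `M`. [cite: MochizukiAbsCusp2007, Prop 2.1 (ii) p.36] -/
def Prop_2_1_ii_model (M : CurveModel.{u}) : Prop :=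
  ∀ (US Ux X : M.Curve) (h₁ : M.IsCofiniteOpen US Ux) (h₂ : M.IsCofiniteOpen Ux X)
    (x : (M.cusps Ux).Cusp),
    M.IsScheme US → M.IsCyclotomePresentation h₂ x → IsMLF (M.base X) →
      (∀ c : (M.cusps US).Cusp, (M.cusps US).IsRational c) →
        Prop_2_1_ii_ker (M.res h₁) (M.res h₂) (fun c : (M.cusps US).Cusp => (M.cusps US).Icusp c)

end AbsCusp

end Literature.AnabelianGeometry.AbsoluteAnabelian
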